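import Summits.AtomisticToContinuum.Crystallization.Theorems.ChargedEnergyGapCleanLedger
import HarnessLib

/-!
# `ChargedEnergyGap` — CORE-FREE configurations leave the far floor; the cored residual and its transfer audit
# (cell `decomp-a2c`, lens 3, generation 51, node «CoreFree», part N-A; over part M-A)

THE ONE TRANSLATION (EQUIV, proved).  Part M-A left the open far end CB-FAR_G = `FarLabelledFloorG`: under the guard and given
the Barlow labellings of the clean plain sites of positive far weight, the clean far account `farCleanExcess` (far-weighted
excess `Σ w·(E_y − e*)` of the clean plain sites) is `≥ −C₁·farNearDebit − c₁·#cores`.  For a configuration WITHOUT incoherent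
cores the far weight is identically `1` (`farWeight_eq_one_of_not_isCore`: the cover `S = Σ_cores bump` vanishes), so the clean
far account is the WHOLE excess minus the near-gross terms: `farCleanExcess = excess − Σ_{near-gross} (E_y − e*)` — and
`excess ≥ 0` (`excess_nonneg'`, `e*` is the infimum) while each near-gross term is at most the rattler cap `max 0 ((ε − e*)/2)`
(`siteExcess_le_cap_of_guard`) and the near-gross sites are dominated by the debit (`sum_farWeight_nearOtherGross_le_farNearDebit`).
Hence ★ `farCleanExcess_coreFree_ge`: `−max 0 ((ε − e*)/2)·farNearDebit ≤ farCleanExcess` for every guarded core-free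
configuration (`0 ≤ ρ₀`; no labelling, no slack, no Cauchy–Born input) and ★★ `farLabelledFloorG_iff_cored`:

  CB-FAR_G ⟺ CB-FAR_G|cored := the same floor asserted only for configurations with AT LEAST ONE incoherent core
  (`FarLabelledFloorCoredG`; coefficient `max C₁ (max 0 ((ε − e*)/2))` backwards).

WHY THIS CUT.  It is weight- and gauge-independent (it survives the repair below) and it puts the residual exactly where the
generation-51 transfer audit says the difficulty — and a probable misstatement — lives: in the transition shells of the far weight
around the cores.  TRANSFER AUDIT (memo g51 §2, all in the tree's units `V = r⁻¹²/12 − r⁻⁶/6`): (i) for a zero-pressure lattice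
and a smooth weight `w` the `w`-weighted force on a site is `−½Σ_v (w(j+v) − w(j))V'(|v|)v̂`; its `∇w` part vanishes by the virial
identity but its THIRD-ORDER part `−(Σ_v V'(|v|)|v|³/60)·w''' = −0.200·w'''` (fcc: `Σ_v V'|v|³ = S₄ − S₁₀ = 12.0`) does not, so a
smooth shell-normal displacement supported in `{0 < w < 1}` lowers the far account at FIRST order while the balls absorb the
difference; harmonic supremum `≈ 3.8·10⁻³·∫(w'')²/w d³x`, per-column `≈ 2.6·10⁻⁴·TV(w_xx)²/Λ³` (`Λ` = shell width);
(ii) COVER SATURATION: the far weight of record is `((1 − Σ_cores bump)₊)⁴` — a SUM — so along a dislocation line with `λ_c ≈ 3`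
core sites per unit length the cover exceeds `1` out to distance `≈ 150` and the shell `{0 < w < 1}` is `≈ 9` wide, not `ϱ/2 = 80`
(`Λ ≈ (ϱ^{7/2}/(644·λ_c))^{2/9}`; `≈ 80/(35·n_c)^{1/4}` around `n_c` coincident cores; `≈ 4.5` along a grain boundary);
(iii) hence the adversarial transfer is `≈ 0.9` per unit length of a straight dislocation dipole (strain `0.7 %`, admissible: the
far sites stay clean, plain and `(1/3, 3)`-labelled, the cores untouched) against the typed slack `c₁·λ_c ≈ 0.17–0.36` per unit
length (+ the dipole's own far field `≲ 0.03–0.4`): CB-FAR_G of record is FALSE-LEANING for line cores by a factor `2–5`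
(uncertainty `×/÷3`; planar cores safe `×30`; compact unimprovable cores, if the sorting admits any, worse `×10–100`) — decided by
a harmonic lattice-statics computation (census C10), NOT claimed here.  REPAIR (part N-B `…ChargedEnergyGapMaxCover`): the
MAX-COVER far weight `(1 − max_cores bump)⁴` has width `80` for every core geometry (transfer `≈ 10⁻²` per unit length, `≈ 1–3`
per isolated compact core); the ledger algebra of parts I-B…M-A only uses `w ∈ [0, 1]`, `w = 0` at cores, periodicity and
`w > 0 ⇒ cores beyond ϱ/2`, all of which it keeps.

§1 Core-free configurations: count `0` ⟺ no core; cover `0`, far weight `1`; ★ the core-free clean far floor.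
§2 CB-FAR_G|cored (`FarLabelledFloorCoredG`), both directions, ★★ the EQUIV `farLabelledFloorG_iff_cored` (`0 ≤ ρ₀`).
§3 RECORD `(…, ϱ, c₁, s, ρ₀, lam, ℓ) = (…, 160, 1/20, 3/5, 10, 1/3, 3)`: the record EQUIV and ★ the eight-leaf record cone with the
   cored leaf, `chargedEnergyGap_of_coredLedger_record` (ChargeRecount · IP_G · FCP_G · CCP_G · REG-BALL_G · LABEL_G · CB-FAR_G|cored · P_G).

TAGS.  CORE-FREE FLOOR: PROVED (rung; weight/gauge-independent).  CB-FAR_G|cored ⟺ CB-FAR_G (EQUIV · proved) · FALSE-LEANING AS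
TYPED at `(ϱ, c₁) = (160, 1/20)` for dislocation-line cores by the transfer audit (KILLABLE: census C10) · after the max-cover
repair TRUE-leaning · ATTACKABLE-L (harmonic: phonon stability + virial + the `∇³` transfer bound; anharmonic: Cauchy–Born).
`[this work]` = cell decomp-a2c lens 3; tree ingredients as named. -/

noncomputable section
open scoped Classical
open Literature.MathematicalPhysics.StatisticalMechanics
open Literature.Geometry.DiscreteGeometry
open Summit.AtomisticToContinuum.Crystallization.Theses.PricedLinkCensus
open Summit.AtomisticToContinuum.Crystallization.Theorems.ChargedEnergyGapNegative

namespace Summit.AtomisticToContinuum.Crystallization.Theorems.ChargedEnergyGapChartDial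

/-! ## §1 Core-free configurations -/

section CoreFree

variable {θ ε R r η L δ L' ϱ ρ₀ s : ℝ}

/-- Incoherent count `0` ⟹ no motif site is an incoherent core. -/
theorem not_isCore_of_motifCoreIncoherent_eq_zero {Q : PeriodicConfiguration 3} (h0 : motifCoreIncoherent θ ε R r η L δ L' Q = 0)
    (x : Q.motif) : ¬ IsCore θ ε R r η L δ L' Q x := by
  intro hx
  have hs := sum_ite_isCore_eq θ ε R r η L δ L' Q
  rw [h0, Nat.cast_zero] at hs
  have h1 : (if IsCore θ ε R r η L δ L' Q x then (1 : ℝ) else 0) ≤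
      ∑ y : Q.motif, (if IsCore θ ε R r η L δ L' Q y then (1 : ℝ) else 0) :=
    Finset.single_le_sum (f := fun y : Q.motif => if IsCore θ ε R r η L δ L' Q y then (1 : ℝ) else 0)
      (fun y _ => by split_ifs <;> norm_num) (Finset.mem_univ x)
  rw [hs, if_pos hx] at h1
  exact absurd h1 (by norm_num)

/-- No incoherent core ⟹ incoherent count `0`. -/
theorem motifCoreIncoherent_eq_zero_of_not_isCore {Q : PeriodicConfiguration 3} (h : ∀ x : Q.motif, ¬ IsCore θ ε R r η L δ L' Q x) :
    motifCoreIncoherent θ ε R r η L δ L' Q = 0 := by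
  have hs := sum_ite_isCore_eq θ ε R r η L δ L' Q
  have h0 : (∑ y : Q.motif, if IsCore θ ε R r η L δ L' Q y then (1 : ℝ) else 0) = 0 :=
    Finset.sum_eq_zero fun y _ => by simp [h y]
  rw [h0] at hs
  exact_mod_cast hs.symm

/-- ★ count `0` ⟺ core-free. -/
theorem motifCoreIncoherent_eq_zero_iff (Q : PeriodicConfiguration 3) :
    motifCoreIncoherent θ ε R r η L δ L' Q = 0 ↔ ∀ x : Q.motif, ¬ IsCore θ ε R r η L δ L' Q x :=
  ⟨not_isCore_of_motifCoreIncoherent_eq_zero, motifCoreIncoherent_eq_zero_of_not_isCore⟩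

/-- Core-free ⟹ the cover vanishes everywhere … -/
theorem coverSum_eq_zero_of_not_isCore {Q : PeriodicConfiguration 3} (h : ∀ x : Q.motif, ¬ IsCore θ ε R r η L δ L' Q x) (q : E3) :
    coverSum θ ε R r η L δ L' ϱ Q q = 0 :=
  Finset.sum_eq_zero fun x _ => coreBump_of_not_isCore (h x) q

/-- … so the far weight is identically `1`: a core-free configuration is ALL far matter. -/
theorem farWeight_eq_one_of_not_isCore {Q : PeriodicConfiguration 3} (h : ∀ x : Q.motif, ¬ IsCore θ ε R r η L δ L' Q x) (q : E3) :
    farWeight θ ε R r η L δ L' ϱ Q q = 1 :=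
  farWeight_eq_one_of_coverSum_eq_zero (coverSum_eq_zero_of_not_isCore h q)

/-- Core-free: the clean far account is the whole excess sum minus the near-gross terms (other-gross sites are near-gross, `0 ≤ ρ₀`). -/
theorem farCleanExcess_eq_of_not_isCore {Q : PeriodicConfiguration 3} (hρ : 0 ≤ ρ₀) (h : ∀ x : Q.motif, ¬ IsCore θ ε R r η L δ L' Q x) :
    farCleanExcess θ ε R r η L δ L' ϱ ρ₀ Q = ∑ y : Q.motif, (siteEnergy Q (y : E3) - eStar) -
      ∑ y : Q.motif, (if NearOtherGross θ ε R r η L δ L' ρ₀ Q y then siteEnergy Q (y : E3) - eStar else 0) := by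
  rw [farCleanExcess, ← Finset.sum_sub_distrib]
  refine Finset.sum_congr rfl fun y _ => ?_
  have hw := farWeight_eq_one_of_not_isCore (ϱ := ϱ) h (y : E3)
  by_cases hg : IsOtherGross θ ε R r η L δ L' Q y
  · have hn : NearOtherGross θ ε R r η L δ L' ρ₀ Q y := IsOtherGross.nearOtherGross hρ hg
    simp [hg, hn]
  · by_cases hn : NearOtherGross θ ε R r η L δ L' ρ₀ Q y
    · simp [hg, hn]
    · simp [hg, hn, hw]

/-- The motif-indexed excess sum is the excess. -/
theorem sum_siteExcess_eq_excess (Q : PeriodicConfiguration 3) : ∑ y : Q.motif, (siteEnergy Q (y : E3) - eStar) = excess Q := by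
  rw [excess_eq_sum]
  exact Finset.sum_coe_sort Q.motif (fun x => siteEnergy Q x - eStar)

/-- ★ **THE CORE-FREE CLEAN FAR FLOOR** (`0 ≤ ρ₀`): for a guarded configuration without incoherent cores,
`−max 0 ((ε − e*)/2) · farNearDebit ≤ farCleanExcess` — the whole excess is `≥ 0` and only the near-gross terms, each at most the
rattler cap and together dominated by the debit, are removed.  No labelling, no slack, no Cauchy–Born input. -/
theorem farCleanExcess_coreFree_ge {Q : PeriodicConfiguration 3} (hG : Guard ε s Q) (hρ : 0 ≤ ρ₀)
    (h0 : ∀ x : Q.motif, ¬ IsCore θ ε R r η L δ L' Q x) :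
    -(max 0 ((ε - eStar) / 2) * farNearDebit θ ε R r η L δ L' ϱ ρ₀ Q) ≤ farCleanExcess θ ε R r η L δ L' ϱ ρ₀ Q := by
  have hc : 0 ≤ max 0 ((ε - eStar) / 2) := le_max_left _ _
  have hw := farWeight_eq_one_of_not_isCore (ϱ := ϱ) h0
  have h1 := farCleanExcess_eq_of_not_isCore (ϱ := ϱ) hρ h0
  have h2 := sum_siteExcess_eq_excess Q
  have h3 : 0 ≤ excess Q := excess_nonneg' Q
  have h4 : (∑ y : Q.motif, if NearOtherGross θ ε R r η L δ L' ρ₀ Q y then siteEnergy Q (y : E3) - eStar else 0) ≤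
      max 0 ((ε - eStar) / 2) *
        ∑ y : Q.motif, (if NearOtherGross θ ε R r η L δ L' ρ₀ Q y then farWeight θ ε R r η L δ L' ϱ Q (y : E3) else 0) := by
    rw [Finset.mul_sum]
    refine Finset.sum_le_sum fun y _ => ?_
    have he := siteExcess_le_cap_of_guard hG y
    split_ifs
    · rw [hw (y : E3), mul_one]; exact he
    · simp
  have h5 := mul_le_mul_of_nonneg_left (sum_farWeight_nearOtherGross_le_farNearDebit θ ε R r η L δ L' ϱ ρ₀ Q) hc
  rw [h1, h2]
  linarith

/-- The core-free floor in the shape of the pieces: the CB-FAR_G / CLEAN-FAR_G inequality holds outright, any `c₁`, with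
`C₁ = max 0 ((ε − e*)/2)`, for every guarded core-free configuration (the slack term is `c₁ · 0`). -/
theorem farCleanFloor_of_not_isCore (c₁ : ℝ) {Q : PeriodicConfiguration 3} (hG : Guard ε s Q) (hρ : 0 ≤ ρ₀)
    (h0 : ∀ x : Q.motif, ¬ IsCore θ ε R r η L δ L' Q x) :
    -(max 0 ((ε - eStar) / 2) * farNearDebit θ ε R r η L δ L' ϱ ρ₀ Q) - c₁ * (motifCoreIncoherent θ ε R r η L δ L' Q : ℝ) ≤
      farCleanExcess θ ε R r η L δ L' ϱ ρ₀ Q := by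
  rw [motifCoreIncoherent_eq_zero_of_not_isCore h0, Nat.cast_zero, mul_zero, sub_zero]
  exact farCleanExcess_coreFree_ge hG hρ h0

end CoreFree

/-! ## §2 The cored residual and ★★ the EQUIV -/

section Cored

variable (θ ε R r η L δ L' ϱ c₁ s ρ₀ lam ℓ : ℝ)

/-- piece CB-FAR_G|cored ⟺ CB-FAR_G (`farLabelledFloorG_iff_cored`) · FALSE-LEANING AS TYPED at the record dial for dislocation-line
cores (transfer audit, memo g51 §2; KILLABLE by census C10) · TRUE-leaning after the max-cover repair (part N-B) · ATTACKABLE-L.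
**FAR FLOOR GIVEN THE LABELLINGS, CORED CONFIGURATIONS ONLY**: `FarLabelledFloorG` asserted only for guarded configurations with
at least one incoherent core — the configurations whose far weight has transition shells.  Why it might fail: a smooth
shell-normal displacement supported in `{0 < w < 1}` lowers `Σ w·(E_y − e*)` at first order through the `∇³w` moment
`−(Σ_v V'|v|³/60)·w'''` while the balls absorb it; with the SUM cover the shell along a line core is `≈ 9` wide and the harmonic
optimum `≈ 0.9` per unit length exceeds the slack `λ_c/20 ≈ 0.17–0.36`. -/
def FarLabelledFloorCoredG : Prop :=
  ∃ C₁ : ℝ, 0 ≤ C₁ ∧ ∀ Q : PeriodicConfiguration 3, Guard ε s Q → 0 < motifCoreIncoherent θ ε R r η L δ L' Q →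
    (∀ y : Q.motif, ¬ IsOtherGross θ ε R r η L δ L' Q y → ¬ NearOtherGross θ ε R r η L δ L' ρ₀ Q y →
        0 < farWeight θ ε R r η L δ L' ϱ Q (y : E3) → LabelledWithin lam ℓ Q (y : E3)) →
      -(C₁ * farNearDebit θ ε R r η L δ L' ϱ ρ₀ Q) - c₁ * (motifCoreIncoherent θ ε R r η L δ L' Q : ℝ) ≤
        farCleanExcess θ ε R r η L δ L' ϱ ρ₀ Q

variable {θ ε R r η L δ L' ϱ c₁ s ρ₀ lam ℓ}

/-- CB-FAR_G ⟹ CB-FAR_G|cored (restriction; same coefficient). -/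
theorem farLabelledFloorCoredG_of_labelledFloor (h : FarLabelledFloorG θ ε R r η L δ L' ϱ c₁ s ρ₀ lam ℓ) :
    FarLabelledFloorCoredG θ ε R r η L δ L' ϱ c₁ s ρ₀ lam ℓ := by
  obtain ⟨C₁, hC, h⟩ := h
  exact ⟨C₁, hC, fun Q hQ _ hlab => h Q hQ hlab⟩

/-- ★ CB-FAR_G|cored ⟹ CB-FAR_G (`0 ≤ ρ₀`; coefficient `max C₁ (max 0 ((ε − e*)/2))`): the core-free configurations are floored by
`farCleanExcess_coreFree_ge`. -/
theorem farLabelledFloorG_of_cored (hρ : 0 ≤ ρ₀) (h : FarLabelledFloorCoredG θ ε R r η L δ L' ϱ c₁ s ρ₀ lam ℓ) :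
    FarLabelledFloorG θ ε R r η L δ L' ϱ c₁ s ρ₀ lam ℓ := by
  obtain ⟨C₁, hC, h⟩ := h
  refine ⟨max C₁ (max 0 ((ε - eStar) / 2)), hC.trans (le_max_left _ _), fun Q hQ hlab => ?_⟩
  have hd : 0 ≤ farNearDebit θ ε R r η L δ L' ϱ ρ₀ Q := farNearDebit_nonneg Q
  by_cases h0 : motifCoreIncoherent θ ε R r η L δ L' Q = 0
  · have hcf := farCleanExcess_coreFree_ge (θ := θ) (R := R) (r := r) (η := η) (L := L) (δ := δ) (L' := L') (ϱ := ϱ) (ρ₀ := ρ₀)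
      hQ hρ (not_isCore_of_motifCoreIncoherent_eq_zero h0)
    have h1 : max 0 ((ε - eStar) / 2) * farNearDebit θ ε R r η L δ L' ϱ ρ₀ Q ≤
        max C₁ (max 0 ((ε - eStar) / 2)) * farNearDebit θ ε R r η L δ L' ϱ ρ₀ Q :=
      mul_le_mul_of_nonneg_right (le_max_right _ _) hd
    rw [h0, Nat.cast_zero, mul_zero, sub_zero]
    linarith
  · have h1 := h Q hQ (Nat.pos_of_ne_zero h0) hlab
    have h2 : C₁ * farNearDebit θ ε R r η L δ L' ϱ ρ₀ Q ≤ max C₁ (max 0 ((ε - eStar) / 2)) * farNearDebit θ ε R r η L δ L' ϱ ρ₀ Q :=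
      mul_le_mul_of_nonneg_right (le_max_left _ _) hd
    linarith

/-- ★★ **CB-FAR_G ⟺ CB-FAR_G|cored** (`0 ≤ ρ₀`): core-free matter leaves the far floor for free — what the far end prices is the
clean plain matter of configurations that do carry incoherent cores, i.e. the transition shells of the far weight. -/
theorem farLabelledFloorG_iff_cored (hρ : 0 ≤ ρ₀) :
    FarLabelledFloorG θ ε R r η L δ L' ϱ c₁ s ρ₀ lam ℓ ↔ FarLabelledFloorCoredG θ ε R r η L δ L' ϱ c₁ s ρ₀ lam ℓ :=
  ⟨farLabelledFloorCoredG_of_labelledFloor, farLabelledFloorG_of_cored hρ⟩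

/-- CB-FAR_G|cored is antitone in the slack: a floor with slack `c₁` is one with any larger slack `c₁'`. -/
theorem FarLabelledFloorCoredG.mono {c₁' : ℝ} (hc : c₁ ≤ c₁') (h : FarLabelledFloorCoredG θ ε R r η L δ L' ϱ c₁ s ρ₀ lam ℓ) :
    FarLabelledFloorCoredG θ ε R r η L δ L' ϱ c₁' s ρ₀ lam ℓ := by
  obtain ⟨C₁, hC, h⟩ := h
  refine ⟨C₁, hC, fun Q hQ hpos hlab => ?_⟩
  have h1 := h Q hQ hpos hlab
  have h2 : c₁ * (motifCoreIncoherent θ ε R r η L δ L' Q : ℝ) ≤ c₁' * (motifCoreIncoherent θ ε R r η L δ L' Q : ℝ) :=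
    mul_le_mul_of_nonneg_right hc (Nat.cast_nonneg _)
  linarith

end Cored

/-! ## §3 The record `(…, ϱ, c₁, s, ρ₀, lam, ℓ) = (…, 160, 1/20, 3/5, 10, 1/3, 3)` -/

section Record

/-- CB-FAR_G of record ⟺ CB-FAR_G|cored of record. -/
theorem farLabelledFloorG_record_iff_cored :
    FarLabelledFloorG (3 / 20) (1 / 10) (6 / 5) 10 (1 / 100) 40 (1 / 10) 40 160 (1 / 20) (3 / 5) 10 (1 / 3) 3 ↔
      FarLabelledFloorCoredG (3 / 20) (1 / 10) (6 / 5) 10 (1 / 100) 40 (1 / 10) 40 160 (1 / 20) (3 / 5) 10 (1 / 3) 3 :=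
  farLabelledFloorG_iff_cored (by norm_num)

/-- The core-free rung at the record: every guarded core-free configuration satisfies the clean far floor of record with
`C₁ = max 0 ((1/10 − e*)/2)` and no slack. -/
theorem farCleanFloor_record_of_not_isCore {Q : PeriodicConfiguration 3} (hG : Guard (1 / 10) (3 / 5) Q)
    (h0 : ∀ x : Q.motif, ¬ IsCore (3 / 20) (1 / 10) (6 / 5) 10 (1 / 100) 40 (1 / 10) 40 Q x) :
    -(max 0 ((1 / 10 - eStar) / 2) * farNearDebit (3 / 20) (1 / 10) (6 / 5) 10 (1 / 100) 40 (1 / 10) 40 160 10 Q) ≤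
      farCleanExcess (3 / 20) (1 / 10) (6 / 5) 10 (1 / 100) 40 (1 / 10) 40 160 10 Q :=
  farCleanExcess_coreFree_ge hG (by norm_num) h0

/-- ★★ **RECORD CONE WITH THE CORED FAR LEAF**, eight named leaves: `ChargeRecount · IP_G · FCP_G · CCP_G · REG-BALL_G · LABEL_G ·
CB-FAR_G|cored · P_G ⟹ ChargedEnergyGap` at `(θ, ε, R, r, η, L, δ, L', ϱ, c₁, s, ρ₀, lam, ℓ) = (3/20, 1/10, 6/5, 10, 1/100, 40,
1/10, 40, 160, 1/20, 3/5, 10, 1/3, 3)`. -/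
theorem chargedEnergyGap_of_coredLedger_record (hF : ChargeRecount)
    (hIP : ImprovablePricingG (3 / 20) (1 / 10) (6 / 5) 10 (1 / 100) (3 / 5))
    (hFCP : FrustratedCorePricingG (3 / 20) (1 / 10) (6 / 5) 10 (1 / 100) 40 (3 / 5))
    (hCCP : CoherentCorePricingG (3 / 20) (1 / 10) (6 / 5) 10 (1 / 100) 40 (1 / 10) 40 (3 / 5))
    (hB : CoreBallRegularPricingG (3 / 20) (1 / 10) (6 / 5) 10 (1 / 100) 40 (1 / 10) 40 160 (1 / 20) (3 / 5) 10 fun _ _ => True)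
    (hLab : CleanLabellingG (3 / 20) (1 / 10) (6 / 5) 10 (1 / 100) 40 (1 / 10) 40 160 (3 / 5) 10 (1 / 3) 3)
    (hCB : FarLabelledFloorCoredG (3 / 20) (1 / 10) (6 / 5) 10 (1 / 100) 40 (1 / 10) 40 160 (1 / 20) (3 / 5) 10 (1 / 3) 3)
    (hP : ChartedChargePricingG (3 / 20) (1 / 10) (3 / 5)) : ChargedEnergyGap :=
  chargedEnergyGap_of_cleanLedger_record hF hIP hFCP hCCP hB hLab (farLabelledFloorG_record_iff_cored.2 hCB) hP

end Record

end Summit.AtomisticToContinuum.Crystallization.Theorems.ChargedEnergyGapChartDial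

end
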